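import Literature.Computability.Complexity.MandersAdlemanLemmas
import Literature.Computability.Complexity.KnapsackPartition
import Literature.Computability.Complexity.IndexAllBricks
import Literature.Computability.Complexity.SumProdFolds
import HarnessLib

/-!
# `KNAPSACK ≤ₚ QUADRATIC CONGRUENCES`: the Manders–Adleman transformation in polynomial time

Machine half no. 2 of the NP-completeness of `QUADCONG` (`QuadraticCongruences.lean`; Manders–Adleman,
J. Comput. System Sci. 16 (1978), §2, Thm. 2 and §2.2 "Analysis of computation time"). The source is
the tree's `KNAPSACK` (Karp's SUBSET SUM, `KarpProblems.lean`; M–A: "the initial steps of the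
algorithm in fact give a reduction of 3-satisfiability to a convenient special case of knapsack") —
an instance `(l, b)` is the `±1` equation `α₀ + ∑ₖ 4 lₖ α_{k+1} = 8b + 1 − 4∑l` (`knapsack_iff_csum`),
to which the number theory of `MandersAdlemanLemmas.lean` applies. This file computes, on the code of
`(l, b)` and in the brick algebra of `FP` string functions (no machine is written by hand):

* the precision `s = size (2 + 8(∑l + b))`, `2^s`, the exponent `e = s + n + 3`, `T = |8b+1−4∑l|`;
* **the odd primes** `p₀ < p₁ < …` in `[3, R + 3)`, `R = 256 (|x| + 2)²`, as a coded list (a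
  concatenation fold over the candidates with a trial-division test `Brick.allIdxFn`; enough of
  them by `MandersAdleman.le_primeCounting'_two_pow`);
* `K = ∏_{j ≤ n} pⱼ^e` (a product fold; `pⱼ^e` by `modExpFn` below a large power of two),
  `θⱼ = Qⱼ tⱼ` with `Qⱼ = K / pⱼ^e` and `tⱼ = MandersAdleman.tOf s Qⱼ pⱼ cⱼ`, `H = ∑ θⱼ` (a sum fold);
* the output code of `(A, 2^{s+1} K, H + 1)` with `A = MandersAdleman.aOf s K H T`, guarded by the
  canonical-code test of `KNAPSACK` codes (`Knapsack.isCanonKFn`).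

Main results: `QuadCong.redF_mem_FP`, `QuadCong.redF_encode` (the value on an instance code),
**`KNAPSACK_karpReducible_QUADCONG : KNAPSACK ≤ₚ QUADCONG`**.

## References

* [MandersAdleman1978] K. L. Manders, L. Adleman, *NP-complete decision problems for binary
  quadratics*, J. Comput. System Sci. 16 (1978) 168–184, §2 (the reduction algorithm, p. 171;
  §2.2 analysis of computation time; Lemma 1, Lemma 2).
* [GareyJohnson1979] M. R. Garey, D. S. Johnson, *Computers and Intractability* (1979), §A7.1 [AN1].
* [AroraBarak2009] S. Arora, B. Barak, *Computational Complexity*, CUP 2009, §1.3 (polynomial time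
  is closed under composition and bounded loops), §0.1 (codes of lists), Def. 2.7 (Karp reductions).
-/

noncomputable section

namespace Literature.Computability.Complexity

open scoped Notation

namespace QuadCong

open _root_.Computability Polynomial Brick HashBricks Plumb Knapsack MandersAdleman Finset

/-! ### The parameters of the transformation (mathematics) -/

/-- The size parameter `S = 2 + 8 (∑ l + b)` (an upper bound for `∑ cⱼ + |τ|`). [cite: MandersAdleman1978, §2 (p. 171)] -/
def sTot (l : List ℕ) (b : ℕ) : ℕ := 2 + 8 * (l.sum + b)

/-- The precision `s = size S` (`2^s > S`). [cite: MandersAdleman1978, §2 (p. 171: the modulus 8^{m+1})] -/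
def sOf (l : List ℕ) (b : ℕ) : ℕ := (sTot l b).size

/-- The exponent `e = s + n + 3` of the prime powers. [cite: MandersAdleman1978, §2 (p. 171: the exponent n+1)] -/
def eOf (l : List ℕ) (b : ℕ) : ℕ := sOf l b + l.length + 3

/-- The coefficients of the `±1` equation of `(l, b)`: `c₀ = 1`, `c_{k+1} = 4 lₖ`. [cite: MandersAdleman1978, §2 (p. 171)] -/
def cOf (l : List ℕ) (j : ℕ) : ℕ := if j = 0 then 1 else 4 * l.getD (j - 1) 0

/-- The target `τ = 8b + 1 − 4 ∑ l` (odd). [cite: MandersAdleman1978, §2 (p. 171: τ)] -/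
def τOf (l : List ℕ) (b : ℕ) : ℤ := 8 * b + 1 - 4 * l.sum

/-- `T = |τ|` as a natural: `(8b+1 ∸ 4∑l) + (4∑l ∸ (8b+1))`. [folklore] -/
def TOf (l : List ℕ) (b : ℕ) : ℕ := (8 * b + 1 - 4 * l.sum) + (4 * l.sum - (8 * b + 1))

-- Implementation note: `ROf`, `plist`, `pOf` are `@[irreducible]`: the structure `sysOf` below stores the
-- function `pOf (ROf L)`, and definitional unfolding of `List.range (256 (L + 2)²)` during `rfl` /
-- `whnf` checks otherwise exhausts the recursion depth. All uses go through the equation lemmas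
-- (`unfold`, `rw`, `simp`).

/-- The number of prime candidates searched: `R = 256 (L + 2)²`, `L` the code length. [cite: MandersAdleman1978, §2.2] -/
@[irreducible] def ROf (L : ℕ) : ℕ := 256 * (L + 2) ^ 2

/-- The primes among the candidates `3, 4, …, R + 2`, in increasing order. [cite: MandersAdleman1978, §2.2 ("we can afford to sieve for the primes")] -/
@[irreducible] def plist (R : ℕ) : List ℕ := ((List.range R).filter fun i => decide (i + 3).Prime).map (· + 3)

/-- The `j`-th base `pⱼ` (`0` past the end of the list). [cite: MandersAdleman1978, §2 (p. 171: p₀, …, pₙ)] -/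
@[irreducible] def pOf (R j : ℕ) : ℕ := (plist R).getD j 0

/-- Members of `plist` are primes `≥ 3`. [folklore] -/
theorem prime_of_mem_plist {R q : ℕ} (h : q ∈ plist R) : q.Prime ∧ 3 ≤ q := by
  unfold plist at h
  simp only [List.mem_map, List.mem_filter, List.mem_range, decide_eq_true_eq] at h
  obtain ⟨i, ⟨-, hp⟩, rfl⟩ := h
  exact ⟨hp, by omega⟩

/-- `plist` has no duplicates. [folklore] -/
theorem nodup_plist (R : ℕ) : (plist R).Nodup := by
  unfold plist
  exact ((List.nodup_range).filter _).map (fun _ _ h => by simpa using h)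

/-- Members of `plist R` are `< R + 3`. [folklore] -/
theorem lt_of_mem_plist {R q : ℕ} (h : q ∈ plist R) : q < R + 3 := by
  unfold plist at h
  simp only [List.mem_map, List.mem_filter, List.mem_range] at h
  obtain ⟨i, ⟨hi, -⟩, rfl⟩ := h
  omega

/-- The length of `plist R` counts the primes in `[3, R + 3)`: it is `π'(R + 3) − 1`. [folklore] -/
theorem length_plist (R : ℕ) : (plist R).length + 1 = Nat.primeCounting' (R + 3) := by
  induction R with
  | zero => unfold plist; decide
  | succ R ih =>
    rw [Nat.primeCounting', show R + 1 + 3 = (R + 3) + 1 by ring, Nat.count_succ, ← Nat.primeCounting', ← ih]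
    unfold plist
    rw [List.range_succ, List.filter_append, List.map_append, List.length_append]
    by_cases h : (R + 3).Prime
    · simp [h]
    · simp [h]

/-- **Enough primes**: `plist (R |x|)` has at least `|x| + 1` members. [cite: MandersAdleman1978, §2.2] -/
theorem length_plist_ROf (L : ℕ) : L + 1 ≤ (plist (ROf L)).length := by
  -- `2^t ≤ R < 2^{t+1}` with `64 (L+2)² ≤ 2^t`
  set t := Nat.log 2 (ROf L) with ht
  have hRpos : 0 < ROf L := by unfold ROf; positivity
  have h1 : ROf L < 2 ^ (t + 1) := Nat.lt_pow_succ_log_self (by norm_num) _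
  have h2 : 2 ^ t ≤ ROf L := Nat.pow_log_le_self 2 hRpos.ne'
  have h64 : 64 * (L + 2) ^ 2 ≤ 2 ^ t := by
    have : ROf L = 2 * (2 * (64 * (L + 2) ^ 2)) := by unfold ROf; ring
    rw [pow_succ] at h1
    omega
  have h3 := le_primeCounting'_two_pow h64
  have h4 : Nat.primeCounting' (2 ^ t) ≤ Nat.primeCounting' (ROf L + 3) := Nat.monotone_primeCounting' (by omega)
  have h5 := length_plist (ROf L)
  omega

/-! ### The bridge: a KNAPSACK instance as a `±1` equation -/

/-- `∑_{j < n+1} αⱼ cⱼ = α₀ + 4 ∑_{k<n} α_{k+1} lₖ`. [folklore] -/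
theorem csum_cOf (l : List ℕ) (ε : ℕ → Bool) :
    ∑ j ∈ range (l.length + 1), sgn (ε j) * (cOf l j : ℤ) =
      sgn (ε 0) + 4 * ∑ k ∈ range l.length, sgn (ε (k + 1)) * (l.getD k 0 : ℤ) := by
  rw [sum_range_succ', mul_sum]
  simp only [cOf, Nat.add_sub_cancel, if_neg (Nat.succ_ne_zero _), if_true, Nat.cast_one, mul_one,
    Nat.cast_mul, Nat.cast_ofNat]
  rw [add_comm]
  congr 1
  exact sum_congr rfl fun k _ => by ring

/-- The masked sum as a signed sum: `2 · maskSum μ l = ∑ l + ∑ₖ αₖ lₖ` with `αₖ = sgn μₖ` (mask read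
with default `false`). [folklore] -/
theorem two_mul_maskSum (μ : List Bool) (l : List ℕ) (hμ : μ.length = l.length) :
    2 * (maskSum μ l : ℤ) = l.sum + ∑ k ∈ range l.length, sgn (μ.getD k false) * (l.getD k 0 : ℤ) := by
  induction l generalizing μ with
  | nil => simp
  | cons a l ih =>
    cases μ with
    | nil => simp at hμ
    | cons m μ =>
      simp only [List.length_cons, Nat.succ.injEq] at hμ
      rw [List.length_cons, sum_range_succ', List.sum_cons]
      simp only [List.getD_cons_succ, List.getD_cons_zero, Nat.cast_add, maskSum_cons_cons]
      have := ih μ hμ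
      cases m
      · simp only [cond_false, Nat.cast_zero, zero_add, sgn_false, neg_one_mul]
        linarith
      · simp only [cond_true, sgn_true, one_mul]
        linarith

/-- **A KNAPSACK instance is a `±1` equation** ("a convenient special case of knapsack"): some
sublist of `l` sums to `b` iff `α₀ + ∑ₖ 4 lₖ α_{k+1} = 8b + 1 − 4∑l` for some signs (`α₀ = 1` is
forced modulo `4`; `αₖ₊₁ = 1` iff `lₖ` is selected). [cite: MandersAdleman1978, §2 (p. 170: "a convenient special case of knapsack")] -/
theorem knapsack_iff_csum (l : List ℕ) (b : ℕ) :
    (l, b) ∈ knapsackSet ↔ ∃ ε : ℕ → Bool, ∑ j ∈ range (l.length + 1), sgn (ε j) * (cOf l j : ℤ) = τOf l b := by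
  constructor
  · rintro ⟨l', hl', hs⟩
    obtain ⟨μ, hμ, hsum⟩ := exists_mask_of_sublist hl'
    simp only at hs
    refine ⟨fun j => if j = 0 then true else μ.getD (j - 1) false, ?_⟩
    rw [csum_cOf]
    simp only [if_true, Nat.add_sub_cancel, if_neg (Nat.succ_ne_zero _), sgn_true]
    have h := two_mul_maskSum μ l hμ
    rw [hsum, hs] at h
    unfold τOf
    linarith
  · rintro ⟨ε, hε⟩
    rw [csum_cOf] at hε
    -- the mask read off the signs
    set μ : List Bool := (List.range l.length).map (fun k => ε (k + 1)) with hμ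
    have hμl : μ.length = l.length := by simp [hμ]
    have hμk : ∀ k < l.length, μ.getD k false = ε (k + 1) := fun k hk => by
      rw [hμ, List.getD_eq_getElem _ _ (by simpa using hk)]; simp
    have h := two_mul_maskSum μ l hμl
    rw [sum_congr rfl (fun k hk => by rw [hμk k (mem_range.1 hk)])] at h
    obtain ⟨l', hl', hs⟩ := exists_sublist_of_mask μ l
    refine ⟨l', hl', ?_⟩
    simp only
    rw [hs]
    unfold τOf at hε
    -- `sgn (ε 0) ≡ 1 (mod 4)` forces `ε 0 = true`
    cases h0 : ε 0
    · rw [h0, sgn_false] at hε; omega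
    · rw [h0, sgn_true] at hε
      have : (maskSum μ l : ℤ) = b := by linarith
      exact_mod_cast this

/-- `τ` is odd. [cite: MandersAdleman1978, §2 Lemma 2 (τ odd)] -/
theorem τOf_odd (l : List ℕ) (b : ℕ) : Odd (τOf l b) := ⟨4 * b - 2 * l.sum, by unfold τOf; ring⟩

/-- `T = |τ|`. [folklore] -/
theorem TOf_eq_natAbs (l : List ℕ) (b : ℕ) : (TOf l b : ℤ) = |τOf l b| := by
  unfold TOf τOf
  rcases le_or_gt (4 * l.sum) (8 * b + 1) with h | h
  · rw [Nat.sub_eq_zero_of_le h, add_zero, abs_of_nonneg (by omega)]; push_cast [h]; ring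
  · rw [Nat.sub_eq_zero_of_le h.le, zero_add, abs_of_neg (by omega)]; push_cast [h.le]; ring

/-- `∑_{k<|l|} l[k] = ∑ l`. [folklore] -/
theorem sum_range_getD (l : List ℕ) : ∑ k ∈ range l.length, l.getD k 0 = l.sum := by
  induction l with
  | nil => simp
  | cons a l ih =>
    rw [List.length_cons, sum_range_succ', List.sum_cons]
    simp only [List.getD_cons_succ, List.getD_cons_zero]
    rw [ih, add_comm]

/-- `∑ cⱼ = 1 + 4 ∑ l`. [folklore] -/
theorem sum_cOf (l : List ℕ) : ∑ j ∈ range (l.length + 1), (cOf l j : ℤ) = 1 + 4 * l.sum := by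
  have h := csum_cOf l (fun _ => true)
  simp only [sgn_true, one_mul] at h
  rw [h, ← sum_range_getD l]
  push_cast
  rw [mul_sum]

/-- The size bound `∑ cⱼ + |τ| < 2^s`. [cite: MandersAdleman1978, §2 (p. 171: choice of the modulus)] -/
theorem small_cOf (l : List ℕ) (b : ℕ) :
    (∑ j ∈ range (l.length + 1), (cOf l j : ℤ)) + |τOf l b| < 2 ^ sOf l b := by
  rw [sum_cOf]
  have h2 : sTot l b < 2 ^ sOf l b := Nat.lt_size_self _
  unfold τOf
  unfold sTot at h2
  generalize l.sum = S at h2 ⊢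
  have h1 : |(8 * b + 1 - 4 * S : ℤ)| ≤ 8 * b + 1 + 4 * S := abs_le.2 ⟨by linarith, by linarith⟩
  zify at h2
  linarith

/-! ### Small arithmetic and size facts -/

/-- `|⌜m⌝| ≤ k ↔ m < 2ᵏ`. [folklore] -/
theorem length_encodeNat_le_iff {m k : ℕ} : (encodeNat m).length ≤ k ↔ m < 2 ^ k := by
  rw [TM2Pass.length_encodeNat_eq_size, Nat.size_le]

/-- `|⌜2ˢ⌝| = s + 1` (twin of `Brick.length_encodeNat_two_pow`, `NatSqrtFP.lean`, not imported). [folklore] -/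
theorem length_encodeNat_two_pow (s : ℕ) : (encodeNat (2 ^ s)).length = s + 1 := by
  rw [TM2Pass.length_encodeNat_eq_size, Nat.size_pow]

/-- `onesFn w = 1^{|w|}` (twin of `QuadCongFP.onesFn_eq_ones` / `CondRed.onesFn_eq_ones`, not imported). [folklore] -/
theorem onesFn_apply' (w : List Bool) : onesFn w = ones w.length := by
  rw [onesFn, Ladder3.unaryEncodeNat_eq_ones']

/-- `tail (ones (k + 1)) = ones k` and `tail (ones 0) = ones 0`: `tail (ones k) = ones (k - 1)`. [folklore] -/
theorem tail_ones (k : ℕ) : (ones k).tail = ones (k - 1) := by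
  cases k <;> simp [ones, List.replicate_succ]

/-- `⟦0 :: w⟧ = 2 ⟦w⟧`. [folklore] -/
theorem bitsToNat_false_cons (w : List Bool) : bitsToNat (false :: w) = 2 * bitsToNat w := by
  simp

/-! ### Stage A: quantities read off the KNAPSACK code `x = ⟨⟨1ⁿ, items⟩, ⌜b⌝⟩` -/

/-- `1ⁿ`. [folklore] -/
def nUF : List Bool → List Bool := fstF ∘ fstF

/-- `⌜∑ l⌝` (`Knapsack.sumListFn` on the list code). [folklore] -/
def sumF : List Bool → List Bool := sumListFn ∘ fstF

/-- `⌜S⌝ = ⌜2 + 8 (∑ l + b)⌝`. [cite: MandersAdleman1978, §2 (p. 171)] -/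
def stotF : List Bool → List Bool :=
  addFn ∘ fanoutFn (fun _ => encodeNat 2) (prodFn ∘ fanoutFn (fun _ => encodeNat 8) (addFn ∘ fanoutFn sumF sndF))

/-- `1ˢ`, `s = |⌜S⌝|`. [folklore] -/
def sUF : List Bool → List Bool := onesFn ∘ stotF

/-- `⌜2ˢ⌝ = ⌜⟦1ˢ⟧ + 1⌝`. [folklore] -/
def m2F : List Bool → List Bool := addFn ∘ fanoutFn sUF (fun _ => [true])

/-- `1ᵉ = 1ˢ 1ⁿ 111`. [folklore] -/
def eUF : List Bool → List Bool := fun z => sUF z ++ (nUF z ++ [true, true, true])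

/-- `⌜8b + 1⌝`. [folklore] -/
def t1F : List Bool → List Bool := addFn ∘ fanoutFn (prodFn ∘ fanoutFn (fun _ => encodeNat 8) sndF) (fun _ => [true])

/-- `⌜4 ∑ l⌝`. [folklore] -/
def t2F : List Bool → List Bool := prodFn ∘ fanoutFn (fun _ => encodeNat 4) sumF

/-- `⌜T⌝ = ⌜(8b+1 ∸ 4∑l) + (4∑l ∸ (8b+1))⌝`. [folklore] -/
def TF : List Bool → List Bool := addFn ∘ fanoutFn (subFn ∘ fanoutFn t1F t2F) (subFn ∘ fanoutFn t2F t1F)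

/-- `nUF ∈ FP`. [folklore] -/
theorem nUF_mem_FP : nUF ∈ FP := comp_mem_FP fstF_mem_FP fstF_mem_FP

/-- `sumF ∈ FP`. [folklore] -/
theorem sumF_mem_FP : sumF ∈ FP := comp_mem_FP sumListFn_mem_FP fstF_mem_FP

/-- `stotF ∈ FP`. [folklore] -/
theorem stotF_mem_FP : stotF ∈ FP :=
  comp_mem_FP addFn_mem_FP (fanoutFn_mem_FP (const_mem_FP _) (comp_mem_FP prodFn_mem_FP
    (fanoutFn_mem_FP (const_mem_FP _) (comp_mem_FP addFn_mem_FP (fanoutFn_mem_FP sumF_mem_FP sndF_mem_FP)))))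

/-- `sUF ∈ FP`. [folklore] -/
theorem sUF_mem_FP : sUF ∈ FP := comp_mem_FP onesFn_mem_FP stotF_mem_FP

/-- `m2F ∈ FP`. [folklore] -/
theorem m2F_mem_FP : m2F ∈ FP := comp_mem_FP addFn_mem_FP (fanoutFn_mem_FP sUF_mem_FP (const_mem_FP _))

/-- `eUF ∈ FP`. [folklore] -/
theorem eUF_mem_FP : eUF ∈ FP := append_mem_FP sUF_mem_FP (append_mem_FP nUF_mem_FP (const_mem_FP _))

/-- `t1F ∈ FP`. [folklore] -/
theorem t1F_mem_FP : t1F ∈ FP :=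
  comp_mem_FP addFn_mem_FP (fanoutFn_mem_FP (comp_mem_FP prodFn_mem_FP (fanoutFn_mem_FP (const_mem_FP _) sndF_mem_FP))
    (const_mem_FP _))

/-- `t2F ∈ FP`. [folklore] -/
theorem t2F_mem_FP : t2F ∈ FP := comp_mem_FP prodFn_mem_FP (fanoutFn_mem_FP (const_mem_FP _) sumF_mem_FP)

/-- `TF ∈ FP`. [folklore] -/
theorem TF_mem_FP : TF ∈ FP :=
  comp_mem_FP addFn_mem_FP (fanoutFn_mem_FP (comp_mem_FP subFn_mem_FP (fanoutFn_mem_FP t1F_mem_FP t2F_mem_FP))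
    (comp_mem_FP subFn_mem_FP (fanoutFn_mem_FP t2F_mem_FP t1F_mem_FP)))

section values

variable (l : List ℕ) (b : ℕ)

/-- `nUF` on a code. [folklore] -/
theorem nUF_encode : nUF (encodingK.encode (l, b)) = ones l.length := by
  rw [encode_K_eq]; simp [nUF]

/-- `sumF` on a code. [folklore] -/
theorem sumF_encode : sumF (encodingK.encode (l, b)) = encodeNat l.sum := by
  rw [sumF, Function.comp_apply, show encodingK.encode (l, b) = boolPair (encodingListNatBool.encode l) (encodeNat b) from rfl,
    fstF_boolPair, sumListFn_encode]

/-- `sndF` on a code is `⌜b⌝`. [folklore] -/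
theorem sndF_encode : sndF (encodingK.encode (l, b)) = encodeNat b := by
  rw [encode_K_eq, sndF_boolPair]

/-- `stotF` on a code. [folklore] -/
theorem stotF_encode : stotF (encodingK.encode (l, b)) = encodeNat (sTot l b) := by
  simp only [stotF, Function.comp_apply, fanoutFn_apply, sumF_encode, sndF_encode, addFn_boolPair, prodFn_boolPair,
    bitsToNat_encodeNat, sTot]

/-- `sUF` on a code. [folklore] -/
theorem sUF_encode : sUF (encodingK.encode (l, b)) = ones (sOf l b) := by
  rw [sUF, Function.comp_apply, stotF_encode, onesFn_apply', TM2Pass.length_encodeNat_eq_size]; rfl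

/-- `m2F` on a code. [folklore] -/
theorem m2F_encode : m2F (encodingK.encode (l, b)) = encodeNat (2 ^ sOf l b) := by
  rw [m2F, Function.comp_apply, fanoutFn_apply, sUF_encode, addFn_boolPair, bitsToNat_ones]
  simp [Nat.sub_add_cancel Nat.one_le_two_pow]

/-- `eUF` on a code. [folklore] -/
theorem eUF_encode : eUF (encodingK.encode (l, b)) = ones (eOf l b) := by
  rw [eUF, sUF_encode, nUF_encode, show [true, true, true] = ones 3 from rfl, Com.ones_append, Com.ones_append]; rfl

/-- `TF` on a code. [folklore] -/
theorem TF_encode : TF (encodingK.encode (l, b)) = encodeNat (TOf l b) := by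
  simp only [TF, t1F, t2F, Function.comp_apply, fanoutFn_apply, sumF_encode, sndF_encode, addFn_boolPair,
    prodFn_boolPair, subFn_boolPair, bitsToNat_encodeNat, bitsToNat_singleton_true, TOf]

end values

/-! ### Stage B: the odd primes below `R + 3` by trial division -/

/-- The candidate `⌜i + 3⌝` on `u = ⟨x, 1ⁱ⟩`. [folklore] -/
def candF : List Bool → List Bool := lenBinF ∘ fun u => sndF u ++ [true, true, true]

/-- The trial divisor `⌜k + 2⌝` on `v = ⟨u, 1ᵏ⟩`. [folklore] -/
def divF : List Bool → List Bool := lenBinF ∘ fun v => sndF v ++ [true, true]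

/-- `[¬ (k + 2) ∣ (i + 3)]` on `v = ⟨u, 1ᵏ⟩`. [cite: MandersAdleman1978, §2.2 ("we can afford to sieve for the primes")] -/
def ndvdF : List Bool → List Bool := notFn (isNilFn ∘ remFn ∘ fanoutFn (candF ∘ fstF) divF)

/-- **The trial-division primality test** `[∀ k < i, ¬ (k+2) ∣ (i+3)] = [(i + 3) is prime]` on
`u = ⟨x, 1ⁱ⟩` (the divisor `i + 2` need not be tried). [cite: MandersAdleman1978, §2.2] -/
def primeTF : List Bool → List Bool := allIdxFn sndF ndvdF

/-- The piece of the prime list at candidate `i`: the frame `⟨⌜i+3⌝, ε⟩` if `i + 3` is prime, else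
`ε`. [folklore] -/
def primePiece : List Bool → List Bool := iteFn primeTF (Ladder3.frameF candF) (fun _ => [])

/-- The number of candidates, as a polynomial in the code length: `R = 256 (L + 2)²`. [cite: MandersAdleman1978, §2.2] -/
def pR : Polynomial ℕ := 256 * (X + 2) ^ 2

/-- `pR.eval L = R L`. [folklore] -/
@[simp] theorem eval_pR (L : ℕ) : pR.eval L = ROf L := by simp [pR, ROf]

/-- **The coded list of the primes in `[3, R + 3)`** (`foldCat` of the prime pieces over the
candidates, clip `28 (L + 1)`). [cite: MandersAdleman1978, §2.2] -/
def PF : List Bool → List Bool := foldCat (28 * (X + 1)) pR primePiece ∘ fanoutFn id (polyFn pR)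

/-- `candF ∈ FP`. [folklore] -/
theorem candF_mem_FP : candF ∈ FP := comp_mem_FP lenBinF_mem_FP (append_mem_FP sndF_mem_FP (const_mem_FP _))

/-- `divF ∈ FP`. [folklore] -/
theorem divF_mem_FP : divF ∈ FP := comp_mem_FP lenBinF_mem_FP (append_mem_FP sndF_mem_FP (const_mem_FP _))

/-- `ndvdF ∈ FP`. [folklore] -/
theorem ndvdF_mem_FP : ndvdF ∈ FP :=
  notFn_mem_FP (comp_mem_FP isNilFn_mem_FP (comp_mem_FP remFn_mem_FP
    (fanoutFn_mem_FP (comp_mem_FP candF_mem_FP fstF_mem_FP) divF_mem_FP)))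

/-- `ndvdF` is one-bit. [folklore] -/
theorem oneBit_ndvdF : OneBit ndvdF := oneBit_notFn (oneBit_isNilFn.comp _)

/-- `primeTF ∈ FP`. [folklore] -/
theorem primeTF_mem_FP : primeTF ∈ FP := allIdxFn_mem_FP sndF_mem_FP ndvdF_mem_FP oneBit_ndvdF

/-- `primePiece ∈ FP`. [folklore] -/
theorem primePiece_mem_FP : primePiece ∈ FP :=
  iteFn_mem_FP primeTF_mem_FP (Ladder3.frameF_mem_FP candF_mem_FP) (const_mem_FP _)

/-- **`PF ∈ FP`.** [cite: MandersAdleman1978, §2.2] [cite: AroraBarak2009, §1.3] -/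
theorem PF_mem_FP : PF ∈ FP :=
  comp_mem_FP (foldCat_mem_FP _ _ primePiece_mem_FP) (fanoutFn_mem_FP OracleCompose.id_mem_FP (polyFn_mem_FP _))

/-- `candF ⟨x, 1ⁱ⟩ = ⌜i + 3⌝`. [folklore] -/
@[simp] theorem candF_apply (x : List Bool) (i : ℕ) : candF (boolPair x (ones i)) = encodeNat (i + 3) := by
  simp [candF, ones]

/-- `ndvdF ⟨⟨x, 1ⁱ⟩, 1ᵏ⟩ = [¬ (k+2) ∣ (i+3)]`. [folklore] -/
theorem ndvdF_apply (x : List Bool) (i k : ℕ) :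
    ndvdF (boolPair (boolPair x (ones i)) (ones k)) = [decide (¬ (k + 2) ∣ (i + 3))] := by
  have hd : divF (boolPair (boolPair x (ones i)) (ones k)) = encodeNat (k + 2) := by simp [divF, ones]
  have hiff : encodeNat ((i + 3) % (k + 2)) = [] ↔ (k + 2) ∣ (i + 3) := by
    rw [Nat.dvd_iff_mod_eq_zero]
    constructor
    · intro h; simpa using congrArg bitsToNat h
    · intro h; rw [h]; rfl
  have h : (isNilFn ∘ remFn ∘ fanoutFn (candF ∘ fstF) divF) (boolPair (boolPair x (ones i)) (ones k)) =
      [decide ((k + 2) ∣ (i + 3))] := by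
    simp only [Function.comp_apply, fanoutFn_apply, fstF_boolPair, candF_apply, hd, remFn_boolPair, bitsToNat_encodeNat,
      isNilFn]
    rw [Bool.decide_congr hiff]
  rw [ndvdF, notFn_apply h]
  by_cases hk : (k + 2) ∣ (i + 3) <;> simp [hk]

/-- Trial division below `q - 1` decides primality of `q ≥ 3`. [folklore] -/
theorem prime_add_three_iff (i : ℕ) : (i + 3).Prime ↔ ∀ k < i, ¬ (k + 2) ∣ (i + 3) := by
  rw [Nat.prime_def_lt']
  constructor
  · rintro ⟨-, h⟩ k hk
    exact h (k + 2) (by omega) (by omega)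
  · intro h
    refine ⟨by omega, fun m hm hmi hdvd => ?_⟩
    rcases Nat.lt_or_ge m (i + 2) with hlt | hge
    · obtain ⟨k, rfl⟩ : ∃ k, m = k + 2 := ⟨m - 2, by omega⟩
      exact h k (by omega) hdvd
    · have hm' : m = i + 2 := by omega
      subst hm'
      have : (i + 2) ∣ 1 := (Nat.dvd_add_right dvd_rfl).1 hdvd
      have := Nat.le_of_dvd Nat.one_pos this
      omega

/-- **Value of the primality test.** [cite: MandersAdleman1978, §2.2] -/
theorem primeTF_apply (x : List Bool) (i : ℕ) : primeTF (boolPair x (ones i)) = [decide (i + 3).Prime] := by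
  rw [primeTF, allIdxFn_apply oneBit_ndvdF (by have := length_fstF_sndF_le (boolPair x (ones i)); omega)]
  simp only [sndF_boolPair, List.length_replicate, ndvdF_apply, List.cons.injEq, and_true, decide_eq_decide]
  rw [prime_add_three_iff]
  simp

/-- **Value of the prime piece.** [folklore] -/
theorem primePiece_apply (x : List Bool) (i : ℕ) :
    primePiece (boolPair x (ones i)) = if (i + 3).Prime then Ladder3.frame (encodeNat (i + 3)) else [] := by
  rw [primePiece, iteFn_apply (primeTF_apply x i)]
  by_cases h : (i + 3).Prime <;> simp [h, Ladder3.frameF_apply]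

/-- The concatenated prime pieces are the coded list of `plist`. [folklore] -/
theorem ccat_primePiece (x : List Bool) : ∀ R : ℕ,
    ccat (fun t => primePiece (boolPair x (ones t))) R = encList ((plist R).map encodeNat)
  | 0 => by unfold plist; rfl
  | R + 1 => by
    rw [ccat_succ, ccat_primePiece x R, primePiece_apply]
    unfold plist
    rw [List.range_succ, List.filter_append, List.map_append, List.map_append, Ladder3.encList_append]
    by_cases h : (R + 3).Prime
    · simp [h, Ladder3.frame_eq, encList_cons]
    · simp [h]

/-- `L + 2 ≤ 2^{L+2}`-type bound: `256 (L+2)² + 3 ≤ 2^{2L+13}`. [folklore] -/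
theorem ROf_add_three_le (L : ℕ) : ROf L + 3 ≤ 2 ^ (2 * L + 13) := by
  have h1 : L + 2 ≤ 2 ^ (L + 2) := (Nat.lt_two_pow_self).le
  have h2 : (L + 2) ^ 2 ≤ 2 ^ (2 * L + 4) := by
    calc (L + 2) ^ 2 ≤ (2 ^ (L + 2)) ^ 2 := Nat.pow_le_pow_left h1 2
      _ = 2 ^ (2 * L + 4) := by rw [← pow_mul]; ring_nf
  have h3 : 3 ≤ 2 ^ (2 * L + 4) := by
    calc 3 ≤ 2 ^ 4 := by norm_num
      _ ≤ 2 ^ (2 * L + 4) := Nat.pow_le_pow_right (by norm_num) (by omega)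
  unfold ROf
  calc 256 * (L + 2) ^ 2 + 3 ≤ 256 * 2 ^ (2 * L + 4) + 2 ^ (2 * L + 4) := Nat.add_le_add (Nat.mul_le_mul_left _ h2) h3
    _ ≤ 512 * 2 ^ (2 * L + 4) := by omega
    _ = 2 ^ (2 * L + 13) := by rw [show 512 = 2 ^ 9 by norm_num, ← pow_add]; ring_nf

/-- The prime pieces are short: `|primePiece ⟨x, 1ⁱ⟩| ≤ 28 (|x| + 1)` for `i < R |x|`. [folklore] -/
theorem length_primePiece_le (x : List Bool) {i : ℕ} (hi : i < ROf x.length) :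
    (primePiece (boolPair x (ones i))).length ≤ (28 * (X + 1) : Polynomial ℕ).eval x.length := by
  rw [primePiece_apply]
  have hlen : (encodeNat (i + 3)).length ≤ 2 * x.length + 13 :=
    length_encodeNat_le_iff.2 (lt_of_lt_of_le (by omega) (ROf_add_three_le x.length))
  split_ifs
  · simp only [Ladder3.length_frame, eval_mul, eval_ofNat, eval_add, eval_X, eval_one]; omega
  · simp

/-- **Value of `PF` on any string**: the coded list of the numerals of `plist (R |x|)`. [cite: MandersAdleman1978, §2.2] -/
theorem PF_apply (x : List Bool) : PF x = encList ((plist (ROf x.length)).map encodeNat) := by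
  rw [PF, Function.comp_apply, fanoutFn_apply, id, polyFn_apply, foldCat_apply (by simp) (fun t ht => ?_), List.length_replicate,
    eval_pR, ccat_primePiece]
  rw [List.length_replicate, eval_pR] at ht
  exact length_primePiece_le x ht

/-! ### The Chinese-remainder data of an instance -/

section sys

variable (l : List ℕ) (b : ℕ)

/-- The length `L` of the code of `(l, b)`. [folklore] -/
def LOf : ℕ := (encodingK.encode (l, b)).length

/-- The code length dominates the number of items: `n + 1 ≤ L`. [folklore] -/
theorem length_lt_LOf : l.length + 1 ≤ LOf l b := by
  unfold LOf; rw [encode_K_eq, length_boolPair, length_boolPair, List.length_replicate]; omega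

/-- The bases of the instance: `pⱼ = plist (R L) [j]`. [cite: MandersAdleman1978, §2 (p. 171: p₀, …, pₙ)] -/
def pL (j : ℕ) : ℕ := pOf (ROf (LOf l b)) j

/-- For `j ≤ n` the base `pⱼ` is a member of `plist (R L)`. [folklore] -/
theorem pL_mem {j : ℕ} (hj : j < l.length + 1) : pL l b j ∈ plist (ROf (LOf l b)) := by
  have hlen : j < (plist (ROf (LOf l b))).length :=
    lt_of_lt_of_le hj ((length_lt_LOf l b).trans ((Nat.le_succ _).trans (length_plist_ROf (LOf l b))))
  unfold pL pOf
  rw [List.getD_eq_getElem _ _ hlen]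
  exact List.getElem_mem hlen

/-- For `j ≤ n`: `pⱼ` is a prime `≥ 3`. [cite: MandersAdleman1978, §2 (p. 171)] -/
theorem pL_spec {j : ℕ} (hj : j < l.length + 1) : (pL l b j).Prime ∧ 3 ≤ pL l b j :=
  prime_of_mem_plist (pL_mem l b hj)

/-- The bases are pairwise distinct. [cite: MandersAdleman1978, §2 (p. 171)] -/
theorem pL_inj : ∀ i < l.length + 1, ∀ j < l.length + 1, pL l b i = pL l b j → i = j := by
  intro i hi j hj h
  have hlen : l.length + 1 ≤ (plist (ROf (LOf l b))).length :=
    (length_lt_LOf l b).trans ((Nat.le_succ _).trans (length_plist_ROf (LOf l b)))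
  unfold pL pOf at h
  rw [List.getD_eq_getElem _ _ (lt_of_lt_of_le hi hlen), List.getD_eq_getElem _ _ (lt_of_lt_of_le hj hlen)] at h
  exact (nodup_plist _).getElem_inj_iff.1 h

/-- `Qⱼ = ∏_{i ≤ n, i ≠ j} pᵢ^e`. [cite: MandersAdleman1978, §2 (p. 171)] -/
def QL (j : ℕ) : ℕ := ∏ i ∈ (range (l.length + 1)).erase j, pL l b i ^ eOf l b

/-- The multipliers `tⱼ = tOf s Qⱼ pⱼ cⱼ`. [cite: MandersAdleman1978, §2 (p. 171: θⱼ)] -/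
def tL (j : ℕ) : ℕ := tOf (sOf l b) (QL l b j) (pL l b j) (cOf l j)

/-- **The Chinese-remainder system of `(l, b)`** (`N = n + 1`, `e = s + n + 3`, the first `n + 1`
primes `≥ 3`, the multipliers `tOf`). [cite: MandersAdleman1978, §2 (p. 171)] -/
def sysOf : Sys where
  N := l.length + 1
  e := eOf l b
  p := pL l b
  t := tL l b
  prime := fun _ hj => (pL_spec l b hj).1
  two_lt := fun _ hj => (pL_spec l b hj).2
  inj := pL_inj l b
  e_pos := by unfold eOf; exact Nat.succ_pos _
  not_dvd := fun j hj => not_dvd_tOf (pL_spec l b hj).1 (by have := (pL_spec l b hj).2; omega)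

/-- `(sysOf l b).Q = QL l b`. [folklore] -/
theorem sysOf_Q (j : ℕ) : (sysOf l b).Q j = QL l b j := rfl

/-- `(sysOf l b).θ j = QL j * tL j`. [folklore] -/
theorem sysOf_θ (j : ℕ) : (sysOf l b).θ j = QL l b j * tL l b j := rfl

/-- `1 ≤ s`. [folklore] -/
theorem one_le_sOf : 1 ≤ sOf l b :=
  Nat.lt_size.2 (by rw [pow_zero]; unfold sTot; omega)

/-- `Qⱼ` is odd. [folklore] -/
theorem QL_odd (j : ℕ) : Odd (QL l b j) := by
  unfold QL
  refine prod_induction _ Odd (fun a b ha hb => ha.mul hb) odd_one fun i hi => Odd.pow ?_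
  obtain ⟨hp, h3⟩ := pL_spec l b (mem_range.1 (mem_of_mem_erase hi))
  exact hp.odd_of_ne_two (by omega)

/-- `K` is odd. [folklore] -/
theorem K_odd : Odd (sysOf l b).K := by
  unfold Sys.K
  refine prod_induction _ Odd (fun a b ha hb => ha.mul hb) odd_one fun i hi => Odd.pow ?_
  obtain ⟨hp, h3⟩ := pL_spec l b (mem_range.1 hi)
  exact hp.odd_of_ne_two (by omega)

/-- **The reduction data of `(l, b)`** (coefficients `cⱼ`, target `τ`, precision `s`, and the
three side conditions: size, congruences `θⱼ ≡ cⱼ (mod 2ˢ)`, `2H < K`). [cite: MandersAdleman1978, §2 (p. 171 and Lemma 1)] -/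
def instOf : Inst where
  S := sysOf l b
  c := cOf l
  τ := τOf l b
  s := sOf l b
  τ_odd := τOf_odd l b
  small := small_cOf l b
  cong := fun j _ => by
    have h := Int.natCast_modEq_iff.2 (mul_tOf_modEq (p := pL l b j) (c := cOf l j) (one_le_sOf l b) (QL_odd l b j))
    push_cast at h
    exact h
  HK := two_mul_H_lt_K (sysOf l b) (s := sOf l b) (fun _ hj => (pL_spec l b hj).2) (fun _ _ => tOf_lt _ _ _ _)
    (show sOf l b + (l.length + 1) + 2 ≤ eOf l b by unfold eOf; omega)

/-- **Correctness of the transformation at the level of numbers**: `(l, b) ∈ knapsackSet` iff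
`(A, 2^{s+1} K, H + 1) ∈ quadCongSet`, `A = aOf s K H T`. [cite: MandersAdleman1978, §2 Thm. 2 (proof of correctness)] -/
theorem knapsack_iff_quadCongSet :
    (l, b) ∈ knapsackSet ↔
      (aOf (sOf l b) (sysOf l b).K (sysOf l b).H (TOf l b), 2 ^ (sOf l b + 1) * (sysOf l b).K, (sysOf l b).H + 1) ∈
        quadCongSet := by
  rw [knapsack_iff_csum]
  have hAM : (aOf (sOf l b) (sysOf l b).K (sysOf l b).H (TOf l b) : ℤ) ≡ (instOf l b).τ ^ 2
      [ZMOD (2 : ℤ) ^ ((instOf l b).s + 1)] := by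
    have h := aOf_modEq_two_pow (s := sOf l b) (K_odd l b) (sysOf l b).H (TOf l b)
    rw [TOf_eq_natAbs, sq_abs] at h
    exact h
  exact (instOf l b).main_quadCongSet hAM (aOf_modEq_K _ _ _ _)

end sys

/-! ### Size bounds along the genuine computation -/

/-- Items of a coded list are shorter than the code (twin of `InvCode.length_le_of_mem_encList`,
`QuantumComplexity/CliffordTInverseCodeFP.lean`, not imported). [folklore] -/
theorem length_le_of_mem_encList {L : List (List Bool)} {u : List Bool} (h : u ∈ L) : u.length ≤ (encList L).length := by
  induction L with
  | nil => simp at h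
  | cons a L ih =>
    rw [encList_cons, length_boolPair]
    rcases List.mem_cons.1 h with rfl | h
    · omega
    · have := ih h; omega

section bounds

variable (l : List ℕ) (b : ℕ)

/-- Every item is `< 2^L`. [folklore] -/
theorem item_lt (a : ℕ) (ha : a ∈ l) : a < 2 ^ LOf l b := by
  have h1 : (encodeNat a).length ≤ (encList (l.map encodeNat)).length :=
    length_le_of_mem_encList (List.mem_map.2 ⟨a, ha, rfl⟩)
  have h2 : (encList (l.map encodeNat)).length ≤ LOf l b := by
    unfold LOf; rw [encode_K_eq, length_boolPair, length_boolPair]; omega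
  have := bitsToNat_lt (encodeNat a)
  rw [bitsToNat_encodeNat] at this
  exact lt_of_lt_of_le this (Nat.pow_le_pow_right (by norm_num) (h1.trans h2))

/-- `b < 2^L`. [folklore] -/
theorem b_lt : b < 2 ^ LOf l b := by
  have h2 : (encodeNat b).length ≤ LOf l b := by
    unfold LOf; rw [encode_K_eq, length_boolPair]; omega
  have := bitsToNat_lt (encodeNat b)
  rw [bitsToNat_encodeNat] at this
  exact lt_of_lt_of_le this (Nat.pow_le_pow_right (by norm_num) h2)

/-- `S < 2^{2L+5}`, so `s ≤ 2L + 5`. [folklore] -/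
theorem sOf_le : sOf l b ≤ 2 * LOf l b + 5 := by
  set L := LOf l b with hL
  have hsum : l.sum ≤ l.length * 2 ^ L := by
    have := List.sum_le_card_nsmul l (2 ^ L) fun a ha => (item_lt l b a ha).le
    simpa using this
  have hn : l.length + 1 ≤ L := length_lt_LOf l b
  have hb : b < 2 ^ L := b_lt l b
  have hL2 : L + 1 ≤ 2 ^ L := Nat.lt_two_pow_self
  have h1 : l.sum + b ≤ 2 ^ L * 2 ^ L := by
    calc l.sum + b ≤ l.length * 2 ^ L + 2 ^ L := by omega
      _ = (l.length + 1) * 2 ^ L := by ring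
      _ ≤ 2 ^ L * 2 ^ L := Nat.mul_le_mul_right _ (by omega)
  unfold sOf
  rw [Nat.size_le]
  unfold sTot
  calc 2 + 8 * (l.sum + b) ≤ 2 + 8 * (2 ^ L * 2 ^ L) := by omega
    _ < 32 * (2 ^ L * 2 ^ L) := by have := Nat.one_le_two_pow (n := L); nlinarith
    _ = 2 ^ (2 * L + 5) := by rw [show 32 = 2 ^ 5 by norm_num, ← pow_add, ← pow_add]; ring_nf

/-- `e ≤ 3L + 8`. [folklore] -/
theorem eOf_le : eOf l b ≤ 3 * LOf l b + 8 := by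
  have := sOf_le l b; have := length_lt_LOf l b; unfold eOf; omega

/-- `pⱼ < 2^{2L+13}` (every member of `plist (R L)` is `< R L + 3`). [folklore] -/
theorem pL_lt (j : ℕ) : pL l b j < 2 ^ (2 * LOf l b + 13) := by
  unfold pL pOf
  set P := plist (ROf (LOf l b)) with hP
  rcases Nat.lt_or_ge j P.length with hj | hj
  · have hmem : P.getD j 0 ∈ P := by rw [List.getD_eq_getElem _ _ hj]; exact List.getElem_mem hj
    exact lt_of_lt_of_le (lt_of_mem_plist hmem) (ROf_add_three_le (LOf l b))
  · rw [List.getD_eq_default _ _ hj]; positivity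

/-- The exponent bound polynomial `D = (2L + 13)(3L + 8)`: `pⱼ^e < 2^D`. [folklore] -/
def pD : Polynomial ℕ := (2 * X + 13) * (3 * X + 8)

/-- `pD.eval L = (2L+13)(3L+8)`. [folklore] -/
@[simp] theorem eval_pD (L : ℕ) : pD.eval L = (2 * L + 13) * (3 * L + 8) := by simp [pD]

/-- **`pⱼ^e < 2^D`.** [folklore] -/
theorem pL_pow_lt (j : ℕ) : pL l b j ^ eOf l b < 2 ^ pD.eval (LOf l b) := by
  rw [eval_pD, pow_mul]
  calc pL l b j ^ eOf l b < (2 ^ (2 * LOf l b + 13)) ^ eOf l b :=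
        Nat.pow_lt_pow_left (pL_lt l b j) (by unfold eOf; omega)
    _ ≤ (2 ^ (2 * LOf l b + 13)) ^ (3 * LOf l b + 8) := Nat.pow_le_pow_right (by positivity) (eOf_le l b)

/-- `K < 2^{D·L}`. [folklore] -/
theorem K_lt : (sysOf l b).K < 2 ^ (pD.eval (LOf l b) * LOf l b) := by
  have h1 : (sysOf l b).K ≤ (2 ^ pD.eval (LOf l b)) ^ (l.length + 1) := by
    unfold Sys.K
    calc ∏ j ∈ range (sysOf l b).N, (sysOf l b).p j ^ (sysOf l b).e ≤ ∏ _j ∈ range (sysOf l b).N, 2 ^ pD.eval (LOf l b) :=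
          prod_le_prod' fun j _ => (pL_pow_lt l b j).le
      _ = (2 ^ pD.eval (LOf l b)) ^ (l.length + 1) := by rw [prod_const, card_range]; rfl
  have h2 : (2 ^ pD.eval (LOf l b)) ^ (l.length + 1) ≤ 2 ^ (pD.eval (LOf l b) * LOf l b) := by
    rw [← pow_mul]; exact Nat.pow_le_pow_right (by norm_num) (Nat.mul_le_mul_left _ (length_lt_LOf l b))
  -- strict: the product of odd numbers is odd, the power of two is even (and `> 1`)
  rcases h1.lt_or_eq with h | h
  · exact lt_of_lt_of_le h h2
  · exfalso
    have hodd := K_odd l b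
    rw [h] at hodd
    exact (Nat.not_even_iff_odd.2 hodd) ((Nat.even_pow' (Nat.succ_ne_zero _)).2 (Nat.even_pow.2 ⟨even_two, by
      have : 0 < pD.eval (LOf l b) := by rw [eval_pD]; positivity
      omega⟩))

/-- `θⱼ < 2^{D·L + 2L + 6}` for `j ≤ n`. [folklore] -/
theorem θ_lt {j : ℕ} (hj : j < l.length + 1) : (sysOf l b).θ j < 2 ^ (pD.eval (LOf l b) * LOf l b + (2 * LOf l b + 6)) := by
  rw [pow_add]
  have hQ : (sysOf l b).Q j ≤ (sysOf l b).K := by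
    rw [← Sys.Q_mul_pow hj]; exact Nat.le_mul_of_pos_right _ (pow_pos (pL_spec l b hj).1.pos _)
  have ht : (sysOf l b).t j < 2 ^ (2 * LOf l b + 6) :=
    lt_of_lt_of_le (tOf_lt _ _ _ _) (Nat.pow_le_pow_right (by norm_num) (by have := sOf_le l b; omega))
  unfold Sys.θ
  calc (sysOf l b).Q j * (sysOf l b).t j < (sysOf l b).Q j * 2 ^ (2 * LOf l b + 6) + 1 := by
        have := Nat.mul_le_mul_left ((sysOf l b).Q j) ht.le; omega
    _ ≤ (sysOf l b).K * 2 ^ (2 * LOf l b + 6) := by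
        have hQpos := Sys.Q_pos (S := sysOf l b) j
        rcases hQ.lt_or_eq with h | h
        · nlinarith [Nat.one_le_two_pow (n := 2 * LOf l b + 6)]
        · -- `Q j = K` forces `p j ^ e = 1`, impossible
          exfalso
          have h2 := Sys.Q_mul_pow (S := sysOf l b) hj
          rw [h] at h2
          have : (sysOf l b).p j ^ (sysOf l b).e = 1 := by
            have hK := Sys.K_pos (S := sysOf l b); nlinarith
          rw [pow_eq_one_iff] at this
          have h3 := (pL_spec l b hj).2
          change 3 ≤ (sysOf l b).p j at h3
          rcases this with h1 | h1
          · omega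
          · exact absurd h1 (show (sysOf l b).e ≠ 0 by change eOf l b ≠ 0; unfold eOf; omega)
    _ < 2 ^ (pD.eval (LOf l b) * LOf l b) * 2 ^ (2 * LOf l b + 6) := Nat.mul_lt_mul_of_pos_right (K_lt l b) (by positivity)

end bounds

/-! ### Stage C: `K = ∏ pⱼ^e` on the context `c₁ = ⟨x, ⟨P, ⟨1ᵉ, ⌜2ˢ⌝⟩⟩⟩` -/

/-- The iterated-pair list code `OracleCompose.body` is `encList` (local copy of
`Brick.body_eq_encList`, `GoldwasserSipserRefereeBricks.lean`, not imported). [folklore] -/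
theorem body_eq_encList'' (L : List (List Bool)) : OracleCompose.body L = encList L := by
  induction L with
  | nil => rfl
  | cons a L ih => rw [OracleCompose.body_cons, encList_cons, ih]

/-- **The context `c₁ = ⟨x, ⟨P, ⟨1ᵉ, ⌜2ˢ⌝⟩⟩⟩`** of the prime-power fold. [folklore] -/
def c1F : List Bool → List Bool := fanoutFn id (fanoutFn PF (fanoutFn eUF m2F))

/-- `c1F ∈ FP`. [folklore] -/
theorem c1F_mem_FP : c1F ∈ FP :=
  fanoutFn_mem_FP OracleCompose.id_mem_FP (fanoutFn_mem_FP PF_mem_FP (fanoutFn_mem_FP eUF_mem_FP m2F_mem_FP))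

section stageC

variable (l : List ℕ) (b : ℕ)

/-- The coded prime list of the instance. [folklore] -/
def Pcode : List Bool := encList ((plist (ROf (LOf l b))).map encodeNat)

/-- The genuine context `c₁`. [folklore] -/
def c1K : List Bool :=
  boolPair (encodingK.encode (l, b)) (boolPair (Pcode l b) (boolPair (ones (eOf l b)) (encodeNat (2 ^ sOf l b))))

/-- `c1F` on a code. [folklore] -/
theorem c1F_encode : c1F (encodingK.encode (l, b)) = c1K l b := by
  rw [c1F, fanoutFn_apply, fanoutFn_apply, fanoutFn_apply, id, PF_apply, eUF_encode, m2F_encode]; rfl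

/-- `|x| ≤ |c₁|`. [folklore] -/
theorem LOf_le_length_c1K : LOf l b ≤ (c1K l b).length := by
  unfold c1K LOf; rw [length_boolPair]; omega

end stageC

/-- On `v = ⟨c₁, 1ʲ⟩`: the numeral `⌜pⱼ⌝` (item `j` of `P`). [folklore] -/
def pjF : List Bool → List Bool := nthItemFn ∘ fanoutFn sndF (nthF 1 ∘ fstF)

/-- On `v`: `⌜2ᴰ⌝`, `D = pD (|x|)` (`⟦1ᴰ⟧ + 1`). [folklore] -/
def bigF : List Bool → List Bool := addFn ∘ fanoutFn (polyFn pD ∘ fstF ∘ fstF) (fun _ => [true])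

/-- On `v`: `⌜e⌝`. [folklore] -/
def eNumF : List Bool → List Bool := lenBinF ∘ nthF 2 ∘ fstF

/-- On `v`: **`⌜pⱼ^e⌝`** as `pⱼ^e mod 2ᴰ` (`modExpFn`; exact since `pⱼ^e < 2ᴰ`). [cite: MandersAdleman1978, §2.2] -/
def pjeF : List Bool → List Bool := modExpFn ∘ fanoutFn pjF (fanoutFn eNumF bigF)

/-- **`⌜K⌝`** on `c₁`: the product fold of `⌜pⱼ^e⌝` over `j < n + 1`. [cite: MandersAdleman1978, §2 (p. 171: K)] -/
def KF : List Bool → List Bool := foldProd pD (X + 1) pjeF ∘ fanoutFn id (List.cons true ∘ fstF ∘ fstF ∘ fstF)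

/-- `pjF ∈ FP`. [folklore] -/
theorem pjF_mem_FP : pjF ∈ FP := comp_mem_FP nthItemFn_mem_FP (fanoutFn_mem_FP sndF_mem_FP (comp_mem_FP (nthF_mem_FP 1) fstF_mem_FP))

/-- `bigF ∈ FP`. [folklore] -/
theorem bigF_mem_FP : bigF ∈ FP :=
  comp_mem_FP addFn_mem_FP (fanoutFn_mem_FP (comp_mem_FP (polyFn_mem_FP _) (comp_mem_FP fstF_mem_FP fstF_mem_FP)) (const_mem_FP _))

/-- `eNumF ∈ FP`. [folklore] -/
theorem eNumF_mem_FP : eNumF ∈ FP := comp_mem_FP lenBinF_mem_FP (comp_mem_FP (nthF_mem_FP 2) fstF_mem_FP)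

/-- `pjeF ∈ FP`. [folklore] -/
theorem pjeF_mem_FP : pjeF ∈ FP := comp_mem_FP modExpFn_mem_FP (fanoutFn_mem_FP pjF_mem_FP (fanoutFn_mem_FP eNumF_mem_FP bigF_mem_FP))

/-- **`KF ∈ FP`.** [cite: AroraBarak2009, §1.3] -/
theorem KF_mem_FP : KF ∈ FP :=
  comp_mem_FP (foldProd_mem_FP _ _ pjeF_mem_FP) (fanoutFn_mem_FP OracleCompose.id_mem_FP
    (comp_mem_FP (cons_mem_FP true) (comp_mem_FP fstF_mem_FP (comp_mem_FP fstF_mem_FP fstF_mem_FP))))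

section stageCvalues

variable (l : List ℕ) (b : ℕ)

/-- `pjF ⟨c₁, 1ʲ⟩ = ⌜pⱼ⌝`. [folklore] -/
theorem pjF_apply (j : ℕ) : pjF (boolPair (c1K l b) (ones j)) = encodeNat (pL l b j) := by
  rw [pjF, Function.comp_apply, fanoutFn_apply, sndF_boolPair, Function.comp_apply, fstF_boolPair, c1K,
    nthF_succ_boolPair, nthF_zero_boolPair, Pcode, ← body_eq_encList'', nthItemFn_body, pL, pOf,
    show ([] : List Bool) = encodeNat 0 from rfl, List.getD_map]

/-- `bigF ⟨c₁, 1ʲ⟩ = ⌜2ᴰ⌝`. [folklore] -/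
theorem bigF_apply (j : ℕ) : bigF (boolPair (c1K l b) (ones j)) = encodeNat (2 ^ pD.eval (LOf l b)) := by
  rw [bigF, Function.comp_apply, fanoutFn_apply, addFn_boolPair]
  simp only [Function.comp_apply, fstF_boolPair, c1K, polyFn_apply, bitsToNat_ones, bitsToNat_singleton_true,
    Nat.sub_add_cancel Nat.one_le_two_pow]
  rfl

/-- `eNumF ⟨c₁, 1ʲ⟩ = ⌜e⌝`. [folklore] -/
theorem eNumF_apply (j : ℕ) : eNumF (boolPair (c1K l b) (ones j)) = encodeNat (eOf l b) := by
  simp [eNumF, c1K]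

/-- **`pjeF ⟨c₁, 1ʲ⟩ = ⌜pⱼ^e⌝`.** [cite: MandersAdleman1978, §2.2] -/
theorem pjeF_apply (j : ℕ) : pjeF (boolPair (c1K l b) (ones j)) = encodeNat (pL l b j ^ eOf l b) := by
  rw [pjeF, Function.comp_apply, fanoutFn_apply, fanoutFn_apply, pjF_apply, eNumF_apply, bigF_apply,
    modExpFn_boolPair (by rw [bitsToNat_encodeNat]; exact Nat.le_self_pow (by rw [eval_pD]; positivity) 2)]
  rw [bitsToNat_encodeNat, bitsToNat_encodeNat, bitsToNat_encodeNat, Nat.mod_eq_of_lt (pL_pow_lt l b j)]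

/-- The genuine context `c = ⟨c₁, ⌜K⌝⟩`. [folklore] -/
def cK : List Bool := boolPair (c1K l b) (encodeNat (sysOf l b).K)

/-- **`KF c₁ = ⌜K⌝`.** [cite: MandersAdleman1978, §2 (p. 171: K)] -/
theorem KF_apply : KF (c1K l b) = encodeNat (sysOf l b).K := by
  have hx : (List.cons true ∘ fstF ∘ fstF ∘ fstF) (c1K l b) = ones (l.length + 1) := by
    simp only [Function.comp_apply, c1K, fstF_boolPair, encode_K_eq]; rfl
  rw [KF, Function.comp_apply, fanoutFn_apply, id, hx, foldProd_apply]
  · simp only [List.length_replicate, pjeF_apply, bitsToNat_encodeNat]; rfl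
  · rw [List.length_replicate, eval_add, eval_X, eval_one]
    have := length_lt_LOf l b; have := LOf_le_length_c1K l b; omega
  · intro t _
    rw [pjeF_apply, length_encodeNat_le_iff]
    exact lt_of_lt_of_le (pL_pow_lt l b t) (Nat.pow_le_pow_right (by norm_num) (TM2Iter.eval_mono _ (LOf_le_length_c1K l b)))

end stageCvalues

/-! ### Stage D: `H = ∑ θⱼ` on the context `c = ⟨c₁, ⌜K⌝⟩` -/

/-- On `w = ⟨c, 1ʲ⟩`: the pair `⟨c₁, 1ʲ⟩` (to reuse the stage-C pieces). [folklore] -/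
def v1F : List Bool → List Bool := fanoutFn (fstF ∘ fstF) sndF

/-- On `w`: `⌜K⌝`. [folklore] -/
def KwF : List Bool → List Bool := sndF ∘ fstF

/-- On `w`: **`⌜Qⱼ⌝ = ⌜K / pⱼ^e⌝`.** [cite: MandersAdleman1978, §2.2 ("each θⱼ is of the form …")] -/
def QjF : List Bool → List Bool := divFn ∘ fanoutFn KwF (pjeF ∘ v1F)

/-- On `w`: `⌜2ˢ⌝` (the last field of `c₁`). [folklore] -/
def M2w : List Bool → List Bool := sndPow 2 ∘ fstF ∘ fstF

/-- On `w`: `1^{s-1}` (exponent `2^{s-1} - 1` of the Euler inverse). [folklore] -/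
def expF : List Bool → List Bool := List.tail ∘ List.tail ∘ onesFn ∘ M2w

/-- On `w`: **`⌜Qⱼ^{2^{s-1}-1} mod 2ˢ⌝`** (the inverse of `Qⱼ` modulo `2ˢ`). [cite: MandersAdleman1978, §2.2 ("the inverse can be found in polynomial time")] -/
def invF : List Bool → List Bool := modExpFn ∘ fanoutFn QjF (fanoutFn expF M2w)

/-- On `w`: the item list of the KNAPSACK code. [folklore] -/
def itemsW : List Bool → List Bool := sndF ∘ fstF ∘ fstF ∘ fstF ∘ fstF

/-- On `w`: **`⌜cⱼ⌝`** (`⌜1⌝` for `j = 0`, `⌜4 l_{j-1}⌝` else). [cite: MandersAdleman1978, §2 (p. 171: cⱼ)] -/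
def cjF : List Bool → List Bool :=
  iteFn (isNilFn ∘ sndF) (fun _ => [true])
    (prodFn ∘ fanoutFn (fun _ => encodeNat 4) (nthItemFn ∘ fanoutFn (List.tail ∘ sndF) itemsW))

/-- On `w`: `⌜t₀⌝ = ⌜cⱼ · inv mod 2ˢ⌝`. [folklore] -/
def t0F : List Bool → List Bool := remFn ∘ fanoutFn (prodFn ∘ fanoutFn cjF invF) M2w

/-- On `w`: `⌜pⱼ⌝`. [folklore] -/
def pjW : List Bool → List Bool := pjF ∘ v1F

/-- On `w`: **`⌜tⱼ⌝ = ⌜tOf s Qⱼ pⱼ cⱼ⌝`.** [cite: MandersAdleman1978, §2 (p. 171: θⱼ ≢ 0 mod pⱼ)] -/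
def tjF : List Bool → List Bool := iteFn (isNilFn ∘ remFn ∘ fanoutFn t0F pjW) (addFn ∘ fanoutFn t0F M2w) t0F

/-- On `w`: **`⌜θⱼ⌝ = ⌜Qⱼ tⱼ⌝`.** [cite: MandersAdleman1978, §2 (p. 171: θⱼ)] -/
def thetaF : List Bool → List Bool := prodFn ∘ fanoutFn QjF tjF

/-- The clip polynomial of the `θ`-pieces: `D·L + 2L + 6`. [folklore] -/
def pH : Polynomial ℕ := pD * X + (2 * X + 6)

/-- **`⌜H⌝`** on `c`: the sum fold of `⌜θⱼ⌝` over `j < n + 1`. [cite: MandersAdleman1978, §2 (p. 171: H)] -/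
def HF : List Bool → List Bool := foldSum pH (X + 1) thetaF ∘ fanoutFn id (List.cons true ∘ fstF ∘ fstF ∘ fstF ∘ fstF)

/-- `v1F ∈ FP`. [folklore] -/
theorem v1F_mem_FP : v1F ∈ FP := fanoutFn_mem_FP (comp_mem_FP fstF_mem_FP fstF_mem_FP) sndF_mem_FP

/-- `KwF ∈ FP`. [folklore] -/
theorem KwF_mem_FP : KwF ∈ FP := comp_mem_FP sndF_mem_FP fstF_mem_FP

/-- `QjF ∈ FP`. [folklore] -/
theorem QjF_mem_FP : QjF ∈ FP := comp_mem_FP divFn_mem_FP (fanoutFn_mem_FP KwF_mem_FP (comp_mem_FP pjeF_mem_FP v1F_mem_FP))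

/-- `M2w ∈ FP`. [folklore] -/
theorem M2w_mem_FP : M2w ∈ FP := comp_mem_FP (sndPow_mem_FP 2) (comp_mem_FP fstF_mem_FP fstF_mem_FP)

/-- `expF ∈ FP`. [folklore] -/
theorem expF_mem_FP : expF ∈ FP :=
  comp_mem_FP PRelSigma.tail_mem_FP (comp_mem_FP PRelSigma.tail_mem_FP (comp_mem_FP onesFn_mem_FP M2w_mem_FP))

/-- `invF ∈ FP`. [folklore] -/
theorem invF_mem_FP : invF ∈ FP := comp_mem_FP modExpFn_mem_FP (fanoutFn_mem_FP QjF_mem_FP (fanoutFn_mem_FP expF_mem_FP M2w_mem_FP))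

/-- `itemsW ∈ FP`. [folklore] -/
theorem itemsW_mem_FP : itemsW ∈ FP :=
  comp_mem_FP sndF_mem_FP (comp_mem_FP fstF_mem_FP (comp_mem_FP fstF_mem_FP (comp_mem_FP fstF_mem_FP fstF_mem_FP)))

/-- `cjF ∈ FP`. [folklore] -/
theorem cjF_mem_FP : cjF ∈ FP :=
  iteFn_mem_FP (comp_mem_FP isNilFn_mem_FP sndF_mem_FP) (const_mem_FP _)
    (comp_mem_FP prodFn_mem_FP (fanoutFn_mem_FP (const_mem_FP _)
      (comp_mem_FP nthItemFn_mem_FP (fanoutFn_mem_FP (comp_mem_FP PRelSigma.tail_mem_FP sndF_mem_FP) itemsW_mem_FP))))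

/-- `t0F ∈ FP`. [folklore] -/
theorem t0F_mem_FP : t0F ∈ FP :=
  comp_mem_FP remFn_mem_FP (fanoutFn_mem_FP (comp_mem_FP prodFn_mem_FP (fanoutFn_mem_FP cjF_mem_FP invF_mem_FP)) M2w_mem_FP)

/-- `pjW ∈ FP`. [folklore] -/
theorem pjW_mem_FP : pjW ∈ FP := comp_mem_FP pjF_mem_FP v1F_mem_FP

/-- `tjF ∈ FP`. [folklore] -/
theorem tjF_mem_FP : tjF ∈ FP :=
  iteFn_mem_FP (comp_mem_FP isNilFn_mem_FP (comp_mem_FP remFn_mem_FP (fanoutFn_mem_FP t0F_mem_FP pjW_mem_FP)))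
    (comp_mem_FP addFn_mem_FP (fanoutFn_mem_FP t0F_mem_FP M2w_mem_FP)) t0F_mem_FP

/-- `thetaF ∈ FP`. [folklore] -/
theorem thetaF_mem_FP : thetaF ∈ FP := comp_mem_FP prodFn_mem_FP (fanoutFn_mem_FP QjF_mem_FP tjF_mem_FP)

/-- **`HF ∈ FP`.** [cite: AroraBarak2009, §1.3] -/
theorem HF_mem_FP : HF ∈ FP :=
  comp_mem_FP (foldSum_mem_FP _ _ thetaF_mem_FP) (fanoutFn_mem_FP OracleCompose.id_mem_FP
    (comp_mem_FP (cons_mem_FP true) (comp_mem_FP fstF_mem_FP (comp_mem_FP fstF_mem_FP (comp_mem_FP fstF_mem_FP fstF_mem_FP)))))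

section stageDvalues

variable (l : List ℕ) (b : ℕ)

/-- `v1F ⟨c, 1ʲ⟩ = ⟨c₁, 1ʲ⟩`. [folklore] -/
@[simp] theorem v1F_apply (j : ℕ) : v1F (boolPair (cK l b) (ones j)) = boolPair (c1K l b) (ones j) := by
  simp [v1F, cK]

/-- `KwF ⟨c, 1ʲ⟩ = ⌜K⌝`. [folklore] -/
@[simp] theorem KwF_apply (j : ℕ) : KwF (boolPair (cK l b) (ones j)) = encodeNat (sysOf l b).K := by
  simp [KwF, cK]

/-- `K / pⱼ^e = Qⱼ`. [folklore] -/
theorem K_div {j : ℕ} (hj : j < l.length + 1) : (sysOf l b).K / pL l b j ^ eOf l b = QL l b j := by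
  have h := Sys.Q_mul_pow (S := sysOf l b) hj
  rw [sysOf_Q] at h
  change QL l b j * pL l b j ^ eOf l b = (sysOf l b).K at h
  rw [← h, Nat.mul_div_cancel _ (pow_pos (pL_spec l b hj).1.pos _)]

/-- **`QjF ⟨c, 1ʲ⟩ = ⌜Qⱼ⌝`** for `j ≤ n`. [cite: MandersAdleman1978, §2.2] -/
theorem QjF_apply {j : ℕ} (hj : j < l.length + 1) : QjF (boolPair (cK l b) (ones j)) = encodeNat (QL l b j) := by
  rw [QjF, Function.comp_apply, fanoutFn_apply, KwF_apply, Function.comp_apply, v1F_apply, pjeF_apply, divFn_boolPair,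
    bitsToNat_encodeNat, bitsToNat_encodeNat, K_div l b hj]

/-- `M2w ⟨c, 1ʲ⟩ = ⌜2ˢ⌝`. [folklore] -/
@[simp] theorem M2w_apply (j : ℕ) : M2w (boolPair (cK l b) (ones j)) = encodeNat (2 ^ sOf l b) := by
  simp [M2w, cK, c1K]

/-- `expF ⟨c, 1ʲ⟩ = 1^{s-1}`. [folklore] -/
theorem expF_apply (j : ℕ) : expF (boolPair (cK l b) (ones j)) = ones (sOf l b - 1) := by
  rw [expF, Function.comp_apply, Function.comp_apply, Function.comp_apply, M2w_apply, onesFn_apply',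
    length_encodeNat_two_pow, tail_ones, tail_ones]; rfl

/-- **`invF ⟨c, 1ʲ⟩ = ⌜Qⱼ^{2^{s-1}-1} mod 2ˢ⌝`** for `j ≤ n`. [cite: MandersAdleman1978, §2.2] -/
theorem invF_apply {j : ℕ} (hj : j < l.length + 1) :
    invF (boolPair (cK l b) (ones j)) = encodeNat (QL l b j ^ (2 ^ (sOf l b - 1) - 1) % 2 ^ sOf l b) := by
  rw [invF, Function.comp_apply, fanoutFn_apply, fanoutFn_apply, QjF_apply l b hj, expF_apply, M2w_apply,
    modExpFn_boolPair (by rw [bitsToNat_encodeNat]; exact Nat.le_self_pow (by have := one_le_sOf l b; omega) 2),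
    bitsToNat_encodeNat, bitsToNat_encodeNat, bitsToNat_ones]

/-- `itemsW ⟨c, 1ʲ⟩` is the item list of the code. [folklore] -/
theorem itemsW_apply (j : ℕ) : itemsW (boolPair (cK l b) (ones j)) = encList (l.map encodeNat) := by
  simp only [itemsW, Function.comp_apply, cK, c1K, fstF_boolPair, encode_K_eq, sndF_boolPair]

/-- **`cjF ⟨c, 1ʲ⟩ = ⌜cⱼ⌝`.** [cite: MandersAdleman1978, §2 (p. 171: cⱼ)] -/
theorem cjF_apply (j : ℕ) : cjF (boolPair (cK l b) (ones j)) = encodeNat (cOf l j) := by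
  unfold cjF cOf
  cases j with
  | zero =>
    rw [iteFn_apply_true (by simp [isNilFn, ones]), if_pos rfl]; rfl
  | succ j =>
    rw [iteFn_apply_false (by simp [isNilFn, ones, List.replicate_succ]), if_neg (Nat.succ_ne_zero j)]
    rw [Function.comp_apply, fanoutFn_apply, prodFn_boolPair, Function.comp_apply, fanoutFn_apply, itemsW_apply,
      Function.comp_apply, sndF_boolPair, tail_ones, Nat.add_sub_cancel, ← body_eq_encList'', nthItemFn_body,
      show ([] : List Bool) = encodeNat 0 from rfl, List.getD_map, bitsToNat_encodeNat, bitsToNat_encodeNat]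

/-- `t0F ⟨c, 1ʲ⟩` for `j ≤ n`. [folklore] -/
theorem t0F_apply {j : ℕ} (hj : j < l.length + 1) :
    t0F (boolPair (cK l b) (ones j)) =
      encodeNat (cOf l j * (QL l b j ^ (2 ^ (sOf l b - 1) - 1) % 2 ^ sOf l b) % 2 ^ sOf l b) := by
  rw [t0F, Function.comp_apply, fanoutFn_apply, Function.comp_apply, fanoutFn_apply, cjF_apply, invF_apply l b hj,
    M2w_apply, prodFn_boolPair, remFn_boolPair, bitsToNat_encodeNat, bitsToNat_encodeNat, bitsToNat_encodeNat,
    bitsToNat_encodeNat]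

/-- `pjW ⟨c, 1ʲ⟩ = ⌜pⱼ⌝`. [folklore] -/
@[simp] theorem pjW_apply (j : ℕ) : pjW (boolPair (cK l b) (ones j)) = encodeNat (pL l b j) := by
  rw [pjW, Function.comp_apply, v1F_apply, pjF_apply]

/-- **`tjF ⟨c, 1ʲ⟩ = ⌜tⱼ⌝`** for `j ≤ n`. [cite: MandersAdleman1978, §2 (p. 171)] -/
theorem tjF_apply {j : ℕ} (hj : j < l.length + 1) : tjF (boolPair (cK l b) (ones j)) = encodeNat (tL l b j) := by
  have hiff : ∀ m q : ℕ, encodeNat (m % q) = [] ↔ q ∣ m := fun m q => by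
    rw [Nat.dvd_iff_mod_eq_zero]
    constructor
    · intro h; simpa using congrArg bitsToNat h
    · intro h; rw [h]; rfl
  -- the intermediate value `t₀`
  generalize ht0 : cOf l j * (QL l b j ^ (2 ^ (sOf l b - 1) - 1) % 2 ^ sOf l b) % 2 ^ sOf l b = t0
  have htL : tL l b j = if pL l b j ∣ t0 then t0 + 2 ^ sOf l b else t0 := by
    unfold tL MandersAdleman.tOf; rw [ht0]
  have h0 : t0F (boolPair (cK l b) (ones j)) = encodeNat t0 := by rw [t0F_apply l b hj, ht0]
  have hc : (isNilFn ∘ remFn ∘ fanoutFn t0F pjW) (boolPair (cK l b) (ones j)) = [decide (pL l b j ∣ t0)] := by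
    simp only [Function.comp_apply, fanoutFn_apply, h0, pjW_apply, remFn_boolPair, bitsToNat_encodeNat, isNilFn]
    rw [Bool.decide_congr (hiff _ _)]
  rw [tjF, iteFn_apply hc, htL]
  by_cases h : pL l b j ∣ t0
  · rw [if_pos (decide_eq_true h), if_pos h, Function.comp_apply, fanoutFn_apply, h0, M2w_apply, addFn_boolPair,
      bitsToNat_encodeNat, bitsToNat_encodeNat]
  · rw [if_neg (by rw [decide_eq_false h]; exact Bool.false_ne_true), if_neg h, h0]

/-- **`thetaF ⟨c, 1ʲ⟩ = ⌜θⱼ⌝`** for `j ≤ n`. [cite: MandersAdleman1978, §2 (p. 171: θⱼ)] -/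
theorem thetaF_apply {j : ℕ} (hj : j < l.length + 1) : thetaF (boolPair (cK l b) (ones j)) = encodeNat ((sysOf l b).θ j) := by
  rw [thetaF, Function.comp_apply, fanoutFn_apply, QjF_apply l b hj, tjF_apply l b hj, prodFn_boolPair, bitsToNat_encodeNat,
    bitsToNat_encodeNat, sysOf_θ]

/-- `|x| ≤ |c|`. [folklore] -/
theorem LOf_le_length_cK : LOf l b ≤ (cK l b).length := by
  unfold cK; rw [length_boolPair]; have := LOf_le_length_c1K l b; omega

/-- **`HF c = ⌜H⌝`.** [cite: MandersAdleman1978, §2 (p. 171: H)] -/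
theorem HF_apply : HF (cK l b) = encodeNat (sysOf l b).H := by
  have hx : (List.cons true ∘ fstF ∘ fstF ∘ fstF ∘ fstF) (cK l b) = ones (l.length + 1) := by
    simp only [Function.comp_apply, cK, c1K, fstF_boolPair, encode_K_eq]; rfl
  rw [HF, Function.comp_apply, fanoutFn_apply, id, hx, foldSum_apply]
  · rw [List.length_replicate, show (sysOf l b).H = ∑ j ∈ range (l.length + 1), (sysOf l b).θ j from rfl]
    exact congrArg encodeNat (sum_congr rfl fun j hj => by rw [thetaF_apply l b (mem_range.1 hj), bitsToNat_encodeNat])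
  · rw [List.length_replicate, eval_add, eval_X, eval_one]
    have := length_lt_LOf l b; have := LOf_le_length_cK l b; omega
  · intro t ht
    rw [List.length_replicate] at ht
    rw [thetaF_apply l b ht, length_encodeNat_le_iff]
    refine lt_of_lt_of_le (θ_lt l b ht) (Nat.pow_le_pow_right (by norm_num) ?_)
    have hmono := TM2Iter.eval_mono pH (LOf_le_length_cK l b)
    have : pH.eval (LOf l b) = pD.eval (LOf l b) * LOf l b + (2 * LOf l b + 6) := by simp [pH]
    omega

end stageDvalues

/-! ### Stage E: the output `⟨⌜A⌝, ⟨⌜2^{s+1} K⌝, ⌜H + 1⌝⟩⟩` on `d = ⟨c, ⌜H⌝⟩` -/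

/-- On `d = ⟨c, ⌜H⌝⟩`: `⌜K⌝`. [folklore] -/
def KdF : List Bool → List Bool := sndF ∘ fstF

/-- On `d`: `⌜2ˢ⌝`. [folklore] -/
def M2d : List Bool → List Bool := sndPow 2 ∘ fstF ∘ fstF

/-- On `d`: the numeral `0⌜2ˢ⌝` of `2^{s+1}`. [folklore] -/
def MdF : List Bool → List Bool := List.cons false ∘ M2d

/-- On `d`: `1ˢ` (value `2ˢ - 1`, the Euler exponent modulo `2^{s+1}`). [folklore] -/
def sUd : List Bool → List Bool := List.tail ∘ onesFn ∘ M2d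

/-- On `d`: **`⌜u⌝ = ⌜K^{2ˢ-1} mod 2^{s+1}⌝`** (the inverse of `K` modulo `2^{s+1}`). [cite: MandersAdleman1978, §2 (p. 171: the inverse in α)] -/
def uF : List Bool → List Bool := modExpFn ∘ fanoutFn KdF (fanoutFn sUd MdF)

/-- On `d`: `⌜H²⌝`. [folklore] -/
def H2F : List Bool → List Bool := prodFn ∘ fanoutFn sndF sndF

/-- On `d`: `⌜T⌝` (recomputed from the code inside `c₁`). [folklore] -/
def TdF : List Bool → List Bool := TF ∘ fstF ∘ fstF ∘ fstF

/-- On `d`: `⌜T²⌝`. [folklore] -/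
def T2F : List Bool → List Bool := prodFn ∘ fanoutFn TdF TdF

/-- On `d`: `⌜(T² mod M + M − H² mod M) · u mod M⌝`, `M = 2^{s+1}`. [cite: MandersAdleman1978, §2 (p. 171: α)] -/
def innerF : List Bool → List Bool :=
  remFn ∘ fanoutFn (prodFn ∘ fanoutFn
    (subFn ∘ fanoutFn (addFn ∘ fanoutFn (remFn ∘ fanoutFn T2F MdF) MdF) (remFn ∘ fanoutFn H2F MdF)) uF) MdF

/-- On `d`: **`⌜A⌝ = ⌜H² + K · inner⌝`.** [cite: MandersAdleman1978, §2 (p. 171: α)] -/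
def AF : List Bool → List Bool := addFn ∘ fanoutFn H2F (prodFn ∘ fanoutFn KdF innerF)

/-- On `d`: **`⌜β⌝ = ⌜2^{s+1} K⌝`.** [cite: MandersAdleman1978, §2 (p. 171: β)] -/
def betaF : List Bool → List Bool := prodFn ∘ fanoutFn MdF KdF

/-- On `d`: **`⌜H + 1⌝`** (Garey–Johnson's bound `c`, `x < c`; M–A's `γ = H`). [cite: GareyJohnson1979, §A7.1 problem AN1] -/
def gamF : List Bool → List Bool := addFn ∘ fanoutFn sndF (fun _ => [true])

/-- On `d`: the output code `⟨⌜A⌝, ⟨⌜β⌝, ⌜H+1⌝⟩⟩`. [cite: MandersAdleman1978, §2 (p. 171: output α, β, γ)] -/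
def outD : List Bool → List Bool := fanoutFn AF (fanoutFn betaF gamF)

/-- **The transformation on codes** (unguarded): `x ↦ outD ⟨c, HF c⟩`, `c = ⟨c₁ x, KF (c₁ x)⟩`. [cite: MandersAdleman1978, §2 (the reduction algorithm)] -/
def outF : List Bool → List Bool := outD ∘ fanoutFn id HF ∘ fanoutFn id KF ∘ c1F

/-- `KdF ∈ FP`. [folklore] -/
theorem KdF_mem_FP : KdF ∈ FP := comp_mem_FP sndF_mem_FP fstF_mem_FP

/-- `M2d ∈ FP`. [folklore] -/
theorem M2d_mem_FP : M2d ∈ FP := comp_mem_FP (sndPow_mem_FP 2) (comp_mem_FP fstF_mem_FP fstF_mem_FP)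

/-- `MdF ∈ FP`. [folklore] -/
theorem MdF_mem_FP : MdF ∈ FP := comp_mem_FP (cons_mem_FP false) M2d_mem_FP

/-- `sUd ∈ FP`. [folklore] -/
theorem sUd_mem_FP : sUd ∈ FP := comp_mem_FP PRelSigma.tail_mem_FP (comp_mem_FP onesFn_mem_FP M2d_mem_FP)

/-- `uF ∈ FP`. [folklore] -/
theorem uF_mem_FP : uF ∈ FP := comp_mem_FP modExpFn_mem_FP (fanoutFn_mem_FP KdF_mem_FP (fanoutFn_mem_FP sUd_mem_FP MdF_mem_FP))

/-- `H2F ∈ FP`. [folklore] -/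
theorem H2F_mem_FP : H2F ∈ FP := comp_mem_FP prodFn_mem_FP (fanoutFn_mem_FP sndF_mem_FP sndF_mem_FP)

/-- `TdF ∈ FP`. [folklore] -/
theorem TdF_mem_FP : TdF ∈ FP := comp_mem_FP TF_mem_FP (comp_mem_FP fstF_mem_FP (comp_mem_FP fstF_mem_FP fstF_mem_FP))

/-- `T2F ∈ FP`. [folklore] -/
theorem T2F_mem_FP : T2F ∈ FP := comp_mem_FP prodFn_mem_FP (fanoutFn_mem_FP TdF_mem_FP TdF_mem_FP)

/-- `innerF ∈ FP`. [folklore] -/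
theorem innerF_mem_FP : innerF ∈ FP :=
  comp_mem_FP remFn_mem_FP (fanoutFn_mem_FP (comp_mem_FP prodFn_mem_FP (fanoutFn_mem_FP
    (comp_mem_FP subFn_mem_FP (fanoutFn_mem_FP
      (comp_mem_FP addFn_mem_FP (fanoutFn_mem_FP (comp_mem_FP remFn_mem_FP (fanoutFn_mem_FP T2F_mem_FP MdF_mem_FP)) MdF_mem_FP))
      (comp_mem_FP remFn_mem_FP (fanoutFn_mem_FP H2F_mem_FP MdF_mem_FP)))) uF_mem_FP)) MdF_mem_FP)

/-- `AF ∈ FP`. [folklore] -/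
theorem AF_mem_FP : AF ∈ FP :=
  comp_mem_FP addFn_mem_FP (fanoutFn_mem_FP H2F_mem_FP (comp_mem_FP prodFn_mem_FP (fanoutFn_mem_FP KdF_mem_FP innerF_mem_FP)))

/-- `betaF ∈ FP`. [folklore] -/
theorem betaF_mem_FP : betaF ∈ FP := comp_mem_FP prodFn_mem_FP (fanoutFn_mem_FP MdF_mem_FP KdF_mem_FP)

/-- `gamF ∈ FP`. [folklore] -/
theorem gamF_mem_FP : gamF ∈ FP := comp_mem_FP addFn_mem_FP (fanoutFn_mem_FP sndF_mem_FP (const_mem_FP _))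

/-- `outD ∈ FP`. [folklore] -/
theorem outD_mem_FP : outD ∈ FP := fanoutFn_mem_FP AF_mem_FP (fanoutFn_mem_FP betaF_mem_FP gamF_mem_FP)

/-- **`outF ∈ FP`.** [cite: MandersAdleman1978, §2.2 (analysis of computation time)] [cite: AroraBarak2009, §1.3] -/
theorem outF_mem_FP : outF ∈ FP :=
  comp_mem_FP outD_mem_FP (comp_mem_FP (fanoutFn_mem_FP OracleCompose.id_mem_FP HF_mem_FP)
    (comp_mem_FP (fanoutFn_mem_FP OracleCompose.id_mem_FP KF_mem_FP) c1F_mem_FP))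

section stageEvalues

variable (l : List ℕ) (b : ℕ)

/-- The genuine record `d = ⟨c, ⌜H⌝⟩`. [folklore] -/
def dK : List Bool := boolPair (cK l b) (encodeNat (sysOf l b).H)

/-- `KdF d = ⌜K⌝`. [folklore] -/
@[simp] theorem KdF_apply : KdF (dK l b) = encodeNat (sysOf l b).K := by simp [KdF, dK, cK]

/-- `M2d d = ⌜2ˢ⌝`. [folklore] -/
@[simp] theorem M2d_apply : M2d (dK l b) = encodeNat (2 ^ sOf l b) := by simp [M2d, dK, cK, c1K]

/-- `⟦MdF d⟧ = 2^{s+1}`. [folklore] -/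
@[simp] theorem bitsToNat_MdF : bitsToNat (MdF (dK l b)) = 2 ^ (sOf l b + 1) := by
  rw [MdF, Function.comp_apply, M2d_apply, bitsToNat_false_cons, bitsToNat_encodeNat, pow_succ, mul_comm]

/-- `⟦sUd d⟧ = 2ˢ - 1`. [folklore] -/
@[simp] theorem bitsToNat_sUd : bitsToNat (sUd (dK l b)) = 2 ^ sOf l b - 1 := by
  rw [sUd, Function.comp_apply, Function.comp_apply, M2d_apply, onesFn_apply', length_encodeNat_two_pow, tail_ones,
    Nat.add_sub_cancel, bitsToNat_ones]

/-- **`uF d = ⌜uOf s K⌝`.** [cite: MandersAdleman1978, §2 (p. 171)] -/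
theorem uF_apply : uF (dK l b) = encodeNat (uOf (sOf l b) (sysOf l b).K) := by
  rw [uF, Function.comp_apply, fanoutFn_apply, fanoutFn_apply, KdF_apply,
    modExpFn_boolPair (by rw [bitsToNat_MdF]; exact Nat.le_self_pow (Nat.succ_ne_zero _) 2), bitsToNat_encodeNat,
    bitsToNat_sUd, bitsToNat_MdF]
  rfl

/-- `H2F d = ⌜H²⌝`. [folklore] -/
@[simp] theorem H2F_apply : H2F (dK l b) = encodeNat ((sysOf l b).H ^ 2) := by
  simp [H2F, dK, pow_two]

/-- `TdF d = ⌜T⌝`. [folklore] -/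
@[simp] theorem TdF_apply : TdF (dK l b) = encodeNat (TOf l b) := by
  simp only [TdF, Function.comp_apply, dK, cK, c1K, fstF_boolPair, TF_encode]

/-- `T2F d = ⌜T²⌝`. [folklore] -/
@[simp] theorem T2F_apply : T2F (dK l b) = encodeNat (TOf l b ^ 2) := by
  simp [T2F, pow_two]

/-- **`AF d = ⌜aOf s K H T⌝`.** [cite: MandersAdleman1978, §2 (p. 171: α)] -/
theorem AF_apply : AF (dK l b) = encodeNat (aOf (sOf l b) (sysOf l b).K (sysOf l b).H (TOf l b)) := by
  simp only [AF, innerF, Function.comp_apply, fanoutFn_apply, H2F_apply, T2F_apply, KdF_apply, uF_apply, addFn_boolPair,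
    prodFn_boolPair, subFn_boolPair, remFn_boolPair, bitsToNat_encodeNat, bitsToNat_MdF, aOf]

/-- **`betaF d = ⌜2^{s+1} K⌝`.** [cite: MandersAdleman1978, §2 (p. 171: β)] -/
theorem betaF_apply : betaF (dK l b) = encodeNat (2 ^ (sOf l b + 1) * (sysOf l b).K) := by
  simp only [betaF, Function.comp_apply, fanoutFn_apply, KdF_apply, prodFn_boolPair, bitsToNat_encodeNat, bitsToNat_MdF]

/-- `gamF d = ⌜H + 1⌝`. [folklore] -/
theorem gamF_apply : gamF (dK l b) = encodeNat ((sysOf l b).H + 1) := by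
  simp [gamF, dK]

/-- **Value of the transformation on an instance code**: the code of
`(A, 2^{s+1} K, H + 1)`. [cite: MandersAdleman1978, §2 (the reduction algorithm, output)] -/
theorem outF_encode : outF (encodingK.encode (l, b)) =
    encodingQuadCong.encode
      (aOf (sOf l b) (sysOf l b).K (sysOf l b).H (TOf l b), 2 ^ (sOf l b + 1) * (sysOf l b).K, (sysOf l b).H + 1) := by
  have h1 : (fanoutFn id KF ∘ c1F) (encodingK.encode (l, b)) = cK l b := by
    rw [Function.comp_apply, c1F_encode, fanoutFn_apply, id, KF_apply]; rfl
  have h2 : fanoutFn id HF (cK l b) = dK l b := by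
    rw [fanoutFn_apply, id, HF_apply]; rfl
  rw [outF, Function.comp_apply, Function.comp_apply, h1, h2, outD, fanoutFn_apply, fanoutFn_apply, AF_apply, betaF_apply,
    gamF_apply, encodingQuadCong_encode]

end stageEvalues

/-! ### The guarded reduction and `KNAPSACK ≤ₚ QUADCONG` -/

/-- A fixed non-member of `QUADCONG` used as an escape: the code of `(0, 1, 1)` (`a = 0` is not a
valid instance). [folklore] -/
def badQ : List Bool := encodingQuadCong.encode (0, 1, 1)

/-- `badQ ∉ QUADCONG`. [folklore] -/
theorem badQ_not_mem : badQ ∉ QUADCONG := fun h => by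
  have := ((encodingQuadCong.mem_toLanguage_iff quadCongSet (0, 1, 1)).1 h)
  rw [mem_quadCongSet_iff] at this
  exact absurd this.1 (lt_irrefl 0)

/-- **The Karp reduction `KNAPSACK → QUADCONG` on codes**: the Manders–Adleman transformation on
KNAPSACK codes, `badQ` on every other string. [cite: MandersAdleman1978, §2 (the reduction algorithm)] -/
def redF : List Bool → List Bool := iteFn isCanonKFn outF (fun _ => badQ)

/-- **`redF ∈ FP`** (M–A §2.2: "All other computations are trivially polynomial time, given the
bounds on the numbers involved"). [cite: MandersAdleman1978, §2.2] [cite: AroraBarak2009, §1.3] -/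
theorem redF_mem_FP : redF ∈ FP := iteFn_mem_FP isCanonKFn_mem_FP outF_mem_FP (const_mem_FP _)

/-- Value of `redF` on an instance code. [folklore] -/
theorem redF_encode (l : List ℕ) (b : ℕ) : redF (encodingK.encode (l, b)) =
    encodingQuadCong.encode
      (aOf (sOf l b) (sysOf l b).K (sysOf l b).H (TOf l b), 2 ^ (sOf l b + 1) * (sysOf l b).K, (sysOf l b).H + 1) := by
  have hc : isCanonKFn (encodingK.encode (l, b)) = [true] := by rw [isCanonKFn_apply, decK_encode]; simp
  rw [redF, iteFn_apply_true hc, outF_encode]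

/-- Value of `redF` on a non-code. [folklore] -/
theorem redF_of_not_canon {x : List Bool} (hx : encodingK.encode (decK x) ≠ x) : redF x = badQ := by
  have hc : isCanonKFn x = [false] := by rw [isCanonKFn_apply]; simp [hx]
  rw [redF, iteFn_apply_false hc]

end QuadCong

/-- **Manders–Adleman 1978: `KNAPSACK ≤ₚ QUADRATIC CONGRUENCES`** — a Karp reduction in the tree's
sense (`≤ₚ`) from Karp's KNAPSACK (SUBSET SUM) to Garey–Johnson's [AN1], by the transformation of
M–A §2 (the `±1` form of the instance, `knapsack_iff_csum`; the Chinese-remainder parameters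
`θⱼ, H, K`; Lemmas 1–2, `MandersAdlemanLemmas.lean`), computed in polynomial time by `QuadCong.redF`.
[cite: MandersAdleman1978, §2 Thm. 2] [cite: GareyJohnson1979, §A7.1 problem AN1] -/
theorem KNAPSACK_karpReducible_QUADCONG : KNAPSACK ≤ₚ QUADCONG := by
  refine ⟨QuadCong.redF, QuadCong.redF_mem_FP, fun x => ?_⟩
  show x ∈ Knapsack.encodingK.toLanguage knapsackSet ↔ QuadCong.redF x ∈ QUADCONG
  by_cases hx : Knapsack.encodingK.encode (Knapsack.decK x) = x
  · rw [← hx, show Knapsack.decK x = ((Knapsack.decK x).1, (Knapsack.decK x).2) from rfl, QuadCong.redF_encode,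
      Knapsack.encodingK.mem_toLanguage_iff, QuadCong.knapsack_iff_quadCongSet, QUADCONG,
      encodingQuadCong.mem_toLanguage_iff]
  · rw [QuadCong.redF_of_not_canon hx]
    exact ⟨fun h => (hx (Knapsack.encode_decK_of_mem h)).elim, fun h => (QuadCong.badQ_not_mem h).elim⟩

end Literature.Computability.Complexity

end
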